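import Literature.Analysis.FluidPDE.PineauVicolOneSliceProofs
import Literature.Analysis.FluidPDE.SpaceTimeRescaling
import Mathlib.Analysis.SpecialFunctions.JapaneseBracket
import HarnessLib

/-!
# Pineau–Vicol 2026, Theorem 1.9 — the printed proof: (9.15)–(9.16), small dissipation at the
  vertex from a small core and the Type I gradient tail

Analysis/FluidPDE proof file, seventh sibling of `PineauVicolOneSlice.lean` (the named fact
`Literature.Analysis.FluidPDE.pineauVicol2026_oneSlice_regularity`, B. Pineau, V. Vicol,
arXiv:2607.09619 (2026), Thm. 1.9). The end of the proof of Prop. 9.5 (p. 33): with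
`r₀ = e^{−s̄/2}`, for `r ≤ r₀` and `t ∈ (−r², 0)`, `s = −log(−t)`,
"`∫_{B_r} |∇u(·,t)|² dx = (−t)^{−1/2} ∫_{B_{r/√−t}} |∇U(·,s)|² dy` … we may thus split the above
integral into `|y| ≤ ½R_{**}` and `|y| ≥ ½R_{**}` to bound
`∫_{|y|≤re^{s/2}} |∇U(·,s)|² dy ≤ ‖∇U(·,s)‖²_{L²(B_{R**/2})} + 8πC²_{U,1}R_{**}⁻¹ ≤ 5θ²_*` (9.15),
by choosing `R_{**} = max{R_*, 8πC²_{U,1}θ_*⁻²}` … Using the bound (9.15) we may then compute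
`r⁻¹ ∫_{Q_r} |∇u|² ≤ 5θ²_* · r⁻¹ ∫_{−r²}^0 (−t)^{−1/2} dt = 10θ²_*` (9.16)."

Here this is rendered **in the physical variables** (the similarity change of variables being
absorbed into the hypotheses): `exists_cknE_le_of_core_small` — there is an absolute `J > 0`
such that, if `∇u` is continuous on `(−1,0) × B₁`, the core is small,
`∫_{|x|<R√(−t)} |∇u(t)|² ≤ 4θ²/√(−t)` for `−T < t < 0` (i.e. `‖∇U(·,s)‖_{L²(B_R)} ≤ 2θ`, the
conclusion of Lemma 9.4 with `R = R_{**}/2`), the Type I gradient bound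
`|∇u(x,t)| ≤ K(|x| + √(−t))⁻²` holds for `|x| + √(−t) ≤ c₁` (Lemma 9.2,
`PineauVicolOneSliceGradient`), and `J K²/R ≤ θ²`, then `E(r) = r⁻¹∫∫_{Q_r}|∇u|² ≤ 10θ²` for all
`0 < r ≤ min(√T, c₁/2, 1)`. The tail `∫_{|x|≥R√(−t)} 3K²|x|⁻⁴ dx ≤ 3K²J₁/(R√(−t))` is obtained by
scaling from `J₁ = ∫_{|η|≥1}|η|⁻⁴ dη < ∞` (`lintegral_norm_rpow_neg_four_ge_le`); the time
integration is the tree's `cknE_le_of_slice_bound` (`PineauVicolOneSliceProofs`). `|∇u|²` is the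
Frobenius norm of the tree's `cknE`, bounded by `3‖∇u‖²`.

## References

* B. Pineau, V. Vicol, arXiv:2607.09619 (2026), proof of Prop. 9.5, (9.15)–(9.16) (p. 33).
  [PineauVicol2026]
-/

noncomputable section

open MeasureTheory Set Function Filter Metric TopologicalSpace
open _root_.Topology
open scoped ENNReal NNReal InnerProductSpace RealInnerProductSpace

namespace Literature.Analysis.FluidPDE

section SmallDissipation

-- nested operator types
set_option maxSynthPendingDepth 3

/-- `∫_{|η| ≥ 1} |η|⁻⁴ dη < ∞` in `ℝ³` (compare with `(1 + |η|)⁻⁴`). [folklore] -/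
theorem lintegral_norm_rpow_neg_four_compl_ball_lt_top :
    ∫⁻ η in {η : EuclideanSpace ℝ (Fin 3) | 1 ≤ ‖η‖}, ENNReal.ofReal (‖η‖ ^ (-(4 : ℝ))) < ⊤ := by
  have hfin := finite_integral_one_add_norm (E := EuclideanSpace ℝ (Fin 3)) (μ := volume) (r := 4)
    (by rw [finrank_euclideanSpace_fin]; norm_num)
  have hle : ∀ η ∈ {η : EuclideanSpace ℝ (Fin 3) | 1 ≤ ‖η‖}, ENNReal.ofReal (‖η‖ ^ (-(4 : ℝ))) ≤
      ENNReal.ofReal ((2 : ℝ) ^ (4 : ℝ)) * ENNReal.ofReal ((1 + ‖η‖) ^ (-(4 : ℝ))) := by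
    intro η hη
    have hη' : (1 : ℝ) ≤ ‖η‖ := hη
    have h0 : 0 < ‖η‖ := by linarith
    rw [← ENNReal.ofReal_mul (by positivity)]
    refine ENNReal.ofReal_le_ofReal ?_
    have h1 : (1 + ‖η‖) ^ (4 : ℝ) ≤ (2 * ‖η‖) ^ (4 : ℝ) :=
      Real.rpow_le_rpow (by positivity) (by linarith) (by norm_num)
    rw [Real.mul_rpow (by norm_num) h0.le] at h1
    have hp1 : 0 < (1 + ‖η‖) ^ (4 : ℝ) := by positivity
    have hp2 : 0 < ‖η‖ ^ (4 : ℝ) := by positivity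
    rw [Real.rpow_neg h0.le, Real.rpow_neg (by positivity), ← div_eq_mul_inv, le_div_iff₀ hp1,
      inv_mul_le_iff₀ hp2]
    linarith
  calc ∫⁻ η in {η : EuclideanSpace ℝ (Fin 3) | 1 ≤ ‖η‖}, ENNReal.ofReal (‖η‖ ^ (-(4 : ℝ)))
      ≤ ∫⁻ η in {η : EuclideanSpace ℝ (Fin 3) | 1 ≤ ‖η‖},
          ENNReal.ofReal ((2 : ℝ) ^ (4 : ℝ)) * ENNReal.ofReal ((1 + ‖η‖) ^ (-(4 : ℝ))) :=
        setLIntegral_mono' (measurableSet_le measurable_const continuous_norm.measurable) hle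
    _ ≤ ∫⁻ η, ENNReal.ofReal ((2 : ℝ) ^ (4 : ℝ)) * ENNReal.ofReal ((1 + ‖η‖) ^ (-(4 : ℝ))) :=
        setLIntegral_le_lintegral _ _
    _ = ENNReal.ofReal ((2 : ℝ) ^ (4 : ℝ)) *
          ∫⁻ η : EuclideanSpace ℝ (Fin 3), ENNReal.ofReal ((1 + ‖η‖) ^ (-(4 : ℝ))) := by
        rw [lintegral_const_mul' _ _ ENNReal.ofReal_ne_top]
    _ < ⊤ := ENNReal.mul_lt_top ENNReal.ofReal_lt_top hfin

/-- **The tail weight at scale `a`**: `∫_{|x| ≥ a} |x|⁻⁴ dx ≤ a⁻¹ ∫_{|η| ≥ 1} |η|⁻⁴ dη` for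
`a > 0` (scaling `x = a η`). [folklore] -/
theorem lintegral_norm_rpow_neg_four_ge_le {a : ℝ} (ha : 0 < a) :
    ∫⁻ x in {x : EuclideanSpace ℝ (Fin 3) | a ≤ ‖x‖}, ENNReal.ofReal (‖x‖ ^ (-(4 : ℝ))) ≤
      ENNReal.ofReal a⁻¹ *
        ∫⁻ η in {η : EuclideanSpace ℝ (Fin 3) | 1 ≤ ‖η‖}, ENNReal.ofReal (‖η‖ ^ (-(4 : ℝ))) := by
  set S : Set (EuclideanSpace ℝ (Fin 3)) := {x | a ≤ ‖x‖} with hS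
  have hSm : MeasurableSet S := measurableSet_le measurable_const continuous_norm.measurable
  set T : Set (EuclideanSpace ℝ (Fin 3)) := {η | 1 ≤ ‖η‖} with hT
  have hTm : MeasurableSet T := measurableSet_le measurable_const continuous_norm.measurable
  set F : EuclideanSpace ℝ (Fin 3) → ℝ≥0∞ := S.indicator fun x => ENNReal.ofReal (‖x‖ ^ (-(4 : ℝ)))
    with hF
  have hscale := lintegral_comp_space_affine ha (0 : EuclideanSpace ℝ (Fin 3)) F
  simp only [zero_add, finrank_euclideanSpace_fin] at hscale
  have hFc : ∀ η : EuclideanSpace ℝ (Fin 3), F (a • η) =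
      ENNReal.ofReal ((a ^ 4)⁻¹) * T.indicator (fun η => ENNReal.ofReal (‖η‖ ^ (-(4 : ℝ)))) η := by
    intro η
    have hmem : a • η ∈ S ↔ η ∈ T := by
      simp only [hS, hT, mem_setOf_eq, norm_smul, Real.norm_of_nonneg ha.le]
      constructor
      · intro h; nlinarith
      · intro h; nlinarith
    by_cases hη : η ∈ T
    · rw [hF, indicator_of_mem (hmem.2 hη), indicator_of_mem hη, norm_smul,
        Real.norm_of_nonneg ha.le, Real.mul_rpow ha.le (norm_nonneg _),
        ENNReal.ofReal_mul (Real.rpow_nonneg ha.le _)]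
      congr 2
      rw [Real.rpow_neg ha.le, show (4 : ℝ) = ((4 : ℕ) : ℝ) by norm_num, Real.rpow_natCast]
    · rw [hF, indicator_of_notMem (fun h => hη (hmem.1 h)), indicator_of_notMem hη, mul_zero]
  have hmeas : Measurable fun η : EuclideanSpace ℝ (Fin 3) =>
      T.indicator (fun η => ENNReal.ofReal (‖η‖ ^ (-(4 : ℝ)))) η :=
    ((continuous_norm.measurable.pow_const _).ennreal_ofReal).indicator hTm
  have h1 : ∫⁻ η, F (a • η) = ENNReal.ofReal ((a ^ 4)⁻¹) *
      ∫⁻ η in T, ENNReal.ofReal (‖η‖ ^ (-(4 : ℝ))) := by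
    simp_rw [hFc]
    rw [lintegral_const_mul _ hmeas, lintegral_indicator hTm]
  have key : ∫⁻ x, F x = ENNReal.ofReal (a ^ 3) * (ENNReal.ofReal ((a ^ 4)⁻¹) *
      ∫⁻ η in T, ENNReal.ofReal (‖η‖ ^ (-(4 : ℝ)))) := by
    rw [← h1, hscale, ← mul_assoc, ← ENNReal.ofReal_mul (by positivity),
      mul_inv_cancel₀ (by positivity), ENNReal.ofReal_one, one_mul]
  rw [← lintegral_indicator hSm, ← hF, key, ← mul_assoc, ← ENNReal.ofReal_mul (by positivity)]
  refine mul_le_mul' (le_of_eq ?_) le_rfl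
  congr 1
  field_simp

/-- **The glue of Prop. 9.5 in physical variables ((9.15)–(9.16)).** There is an absolute
constant `J > 0` such that: if `∇u` is continuous on `(−1,0) × B₁`, the *core* dissipation is
small, `√(−t) ∫_{|x| < R√(−t)} |∇u(t)|² ≤ 4θ²` for `−T < t < 0` (in similarity variables:
`‖∇U(·, s)‖_{L²(B_R)} ≤ 2θ` for `s ≥ −log T`, the conclusion of Lemma 9.4), the gradient
obeys the Type I bound `|∇u(x,t)| ≤ K(|x| + √(−t))⁻²` for `|x| + √(−t) ≤ c₁` (Lemma 9.2), and
`J K²/R ≤ θ²` (the choice `R_{**} ≥ 8πC²_{U,1}θ⁻²` of the paper), then for every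
`0 < r ≤ min(√T, c₁/2, 1)` the slice bound `∫_{B_r} |∇u(t)|² ≤ 5θ²/√(−t)` ((9.15)) holds on
`(−r², 0)` and hence `E(r) = r⁻¹ ∫∫_{Q_r} |∇u|² ≤ 10θ²` ((9.16)). Here `|∇u|²` is the
Frobenius norm (`frobeniusNormSq`, as in the tree's `cknE`) and the tail is bounded by
`∫_{|x| ≥ R√(−t)} 3K²|x|⁻⁴ dx ≤ 3K² J₁/(R√(−t))`. [cite: PineauVicol2026, proof of Prop. 9.5, (9.15)–(9.16), arXiv:2607.09619 p. 33] -/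
theorem exists_cknE_le_of_core_small :
    ∃ J : ℝ, 0 < J ∧ ∀ (u : ℝ → EuclideanSpace ℝ (Fin 3) → EuclideanSpace ℝ (Fin 3))
      (θ K c₁ R T : ℝ), 0 < θ → 0 ≤ K → 0 < c₁ → 0 < R → 0 < T →
      ContinuousOn (fun w : ℝ × EuclideanSpace ℝ (Fin 3) => fderiv ℝ (u w.1) w.2)
        (Ioo (-1 : ℝ) 0 ×ˢ ball (0 : EuclideanSpace ℝ (Fin 3)) 1) →
      (∀ t ∈ Ioo (-T) 0,
        ∫⁻ x in ball (0 : EuclideanSpace ℝ (Fin 3)) (R * Real.sqrt (-t)),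
          ENNReal.ofReal (frobeniusNormSq (fderiv ℝ (u t) x)) ≤
            ENNReal.ofReal (4 * θ ^ 2 / Real.sqrt (-t))) →
      (∀ t ∈ Ioo (-1 : ℝ) 0, ∀ x : EuclideanSpace ℝ (Fin 3), ‖x‖ + Real.sqrt (-t) ≤ c₁ →
        ‖fderiv ℝ (u t) x‖ ≤ K / (‖x‖ + Real.sqrt (-t)) ^ 2) →
      J * K ^ 2 / R ≤ θ ^ 2 →
      ∀ r : ℝ, 0 < r → r ≤ Real.sqrt T → r ≤ c₁ / 2 → r ≤ 1 →
        cknE r (0 : ℝ × EuclideanSpace ℝ (Fin 3)) (fun t x => fderiv ℝ (u t) x) ≤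
          ENNReal.ofReal (10 * θ ^ 2) := by
  set J₁e : ℝ≥0∞ := ∫⁻ η in {η : EuclideanSpace ℝ (Fin 3) | 1 ≤ ‖η‖},
    ENNReal.ofReal (‖η‖ ^ (-(4 : ℝ))) with hJ₁e
  have hJ₁top : J₁e ≠ ⊤ := lintegral_norm_rpow_neg_four_compl_ball_lt_top.ne
  set J₁ : ℝ := J₁e.toReal with hJ₁
  have hJ₁0 : 0 ≤ J₁ := ENNReal.toReal_nonneg
  refine ⟨3 * J₁ + 1, by positivity, ?_⟩
  intro u θ K c₁ R T hθ hK hc₁ hR hT hcont hcore hgrad hJR r hr hrT hrc hr1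
  -- `3 K² J₁ / R ≤ θ²`
  have htailc : 3 * K ^ 2 * J₁ / R ≤ θ ^ 2 := by
    refine le_trans ?_ hJR
    rw [div_le_div_iff_of_pos_right hR]
    nlinarith [sq_nonneg K]
  -- measurability of `|∇u|²` on `Q_r(0)`
  have hQsub : parabolicCylinder r (0 : ℝ × EuclideanSpace ℝ (Fin 3)) ⊆
      Ioo (-1 : ℝ) 0 ×ˢ ball (0 : EuclideanSpace ℝ (Fin 3)) 1 := by
    intro w hw
    rw [mem_parabolicCylinder] at hw
    obtain ⟨⟨h1, h2⟩, h3⟩ := hw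
    simp only [Prod.fst_zero, Prod.snd_zero, zero_sub] at h1 h2 h3
    refine mk_mem_prod ⟨by nlinarith, h2⟩ ?_
    rw [mem_ball]; linarith
  have hFc : ContinuousOn (fun w : ℝ × EuclideanSpace ℝ (Fin 3) =>
      ENNReal.ofReal (frobeniusNormSq (fderiv ℝ (u w.1) w.2)))
      (parabolicCylinder r (0 : ℝ × EuclideanSpace ℝ (Fin 3))) := by
    have hfrob : Continuous fun L : EuclideanSpace ℝ (Fin 3) →L[ℝ] EuclideanSpace ℝ (Fin 3) =>
        frobeniusNormSq L := by
      unfold frobeniusNormSq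
      exact continuous_finsetSum _ fun i _ =>
        ((ContinuousLinearMap.apply ℝ (EuclideanSpace ℝ (Fin 3)) _).continuous.norm).pow 2
    exact ENNReal.continuous_ofReal.comp_continuousOn (hfrob.comp_continuousOn (hcont.mono hQsub))
  have hFm : AEMeasurable (fun w : ℝ × EuclideanSpace ℝ (Fin 3) =>
      ENNReal.ofReal (frobeniusNormSq (fderiv ℝ (u w.1) w.2)))
      (volume.restrict (parabolicCylinder r (0 : ℝ × EuclideanSpace ℝ (Fin 3)))) :=
    (hFc.aestronglyMeasurable (isOpen_parabolicCylinder r 0).measurableSet).aemeasurable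
  -- Frobenius versus operator norm
  have hfrob3 : ∀ L : EuclideanSpace ℝ (Fin 3) →L[ℝ] EuclideanSpace ℝ (Fin 3),
      frobeniusNormSq L ≤ 3 * ‖L‖ ^ 2 := by
    intro L
    unfold frobeniusNormSq
    set b := stdOrthonormalBasis ℝ (EuclideanSpace ℝ (Fin 3))
    calc ∑ i, ‖L (b i)‖ ^ 2 ≤ ∑ _i : Fin (Module.finrank ℝ (EuclideanSpace ℝ (Fin 3))), ‖L‖ ^ 2 := by
          refine Finset.sum_le_sum fun i _ => ?_
          have h : ‖L (b i)‖ ≤ ‖L‖ := by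
            calc ‖L (b i)‖ ≤ ‖L‖ * ‖b i‖ := L.le_opNorm _
              _ = ‖L‖ := by rw [b.orthonormal.1 i, mul_one]
          exact pow_le_pow_left₀ (norm_nonneg _) h 2
      _ = 3 * ‖L‖ ^ 2 := by
          rw [Finset.sum_const, Finset.card_univ, Fintype.card_fin, finrank_euclideanSpace_fin,
            nsmul_eq_mul, Nat.cast_ofNat]
  -- the slice bound (9.15)
  have hslice : ∀ t ∈ Ioo (-r ^ 2) 0,
      ∫⁻ x in ball (0 : EuclideanSpace ℝ (Fin 3)) r, ENNReal.ofReal (frobeniusNormSq (fderiv ℝ (u t) x)) ≤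
        ENNReal.ofReal (5 * θ ^ 2 / Real.sqrt (-t)) := by
    intro t ht
    have ht0 : t < 0 := ht.2
    have hsq : 0 < Real.sqrt (-t) := Real.sqrt_pos.2 (by linarith)
    have htT : t ∈ Ioo (-T) 0 := by
      refine ⟨?_, ht0⟩
      have : r ^ 2 ≤ T := by
        calc r ^ 2 ≤ (Real.sqrt T) ^ 2 := pow_le_pow_left₀ hr.le hrT 2
          _ = T := Real.sq_sqrt hT.le
      linarith [ht.1]
    have ht1 : t ∈ Ioo (-1 : ℝ) 0 := ⟨by nlinarith [ht.1], ht0⟩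
    have hsqr : Real.sqrt (-t) < r := by
      calc Real.sqrt (-t) < Real.sqrt (r ^ 2) := Real.sqrt_lt_sqrt (by linarith) (by linarith [ht.1])
        _ = r := Real.sqrt_sq hr.le
    set a : ℝ := R * Real.sqrt (-t) with ha
    have ha0 : 0 < a := by positivity
    -- split the ball into the core and the tail
    set core : Set (EuclideanSpace ℝ (Fin 3)) := ball 0 a with hcore_def
    set tail : Set (EuclideanSpace ℝ (Fin 3)) := ball 0 r ∩ {x | a ≤ ‖x‖} with htail_def
    have hcover : ball (0 : EuclideanSpace ℝ (Fin 3)) r ⊆ core ∪ tail := by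
      intro x hx
      by_cases h : ‖x‖ < a
      · exact Or.inl (mem_ball_zero_iff.2 h)
      · exact Or.inr ⟨hx, not_lt.1 h⟩
    have htailm : MeasurableSet tail :=
      measurableSet_ball.inter (measurableSet_le measurable_const continuous_norm.measurable)
    -- the tail: `|∇u|² ≤ 3K²|x|⁻⁴`
    have htail_pt : ∀ x ∈ tail, ENNReal.ofReal (frobeniusNormSq (fderiv ℝ (u t) x)) ≤
        ENNReal.ofReal (3 * K ^ 2) * ENNReal.ofReal (‖x‖ ^ (-(4 : ℝ))) := by
      intro x hx
      have hxr : ‖x‖ < r := mem_ball_zero_iff.1 hx.1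
      have hxa : a ≤ ‖x‖ := hx.2
      have hx0 : 0 < ‖x‖ := lt_of_lt_of_le ha0 hxa
      have hsmall : ‖x‖ + Real.sqrt (-t) ≤ c₁ := by linarith
      have hg := hgrad t ht1 x hsmall
      have h1 : frobeniusNormSq (fderiv ℝ (u t) x) ≤ 3 * K ^ 2 * ‖x‖ ^ (-(4 : ℝ)) := by
        refine (hfrob3 _).trans ?_
        have h2 : ‖fderiv ℝ (u t) x‖ ^ 2 ≤ (K / (‖x‖ + Real.sqrt (-t)) ^ 2) ^ 2 :=
          pow_le_pow_left₀ (norm_nonneg _) hg 2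
        have h3 : (K / (‖x‖ + Real.sqrt (-t)) ^ 2) ^ 2 ≤ K ^ 2 * ‖x‖ ^ (-(4 : ℝ)) := by
          rw [div_pow, Real.rpow_neg hx0.le, show (4 : ℝ) = ((4 : ℕ) : ℝ) by norm_num,
            Real.rpow_natCast, div_eq_mul_inv]
          refine mul_le_mul_of_nonneg_left ?_ (sq_nonneg K)
          refine inv_anti₀ (pow_pos hx0 4) ?_
          have : ‖x‖ ^ 2 ≤ (‖x‖ + Real.sqrt (-t)) ^ 2 :=
            pow_le_pow_left₀ hx0.le (by linarith [hsq.le]) 2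
          nlinarith
        nlinarith
      rw [← ENNReal.ofReal_mul (by positivity)]
      exact ENNReal.ofReal_le_ofReal (by linarith)
    have htail_int : ∫⁻ x in tail, ENNReal.ofReal (frobeniusNormSq (fderiv ℝ (u t) x)) ≤
        ENNReal.ofReal (3 * K ^ 2 * J₁ / (R * Real.sqrt (-t))) := by
      calc ∫⁻ x in tail, ENNReal.ofReal (frobeniusNormSq (fderiv ℝ (u t) x))
          ≤ ∫⁻ x in tail, ENNReal.ofReal (3 * K ^ 2) * ENNReal.ofReal (‖x‖ ^ (-(4 : ℝ))) :=
            setLIntegral_mono' htailm htail_pt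
        _ = ENNReal.ofReal (3 * K ^ 2) * ∫⁻ x in tail, ENNReal.ofReal (‖x‖ ^ (-(4 : ℝ))) := by
            rw [lintegral_const_mul' _ _ ENNReal.ofReal_ne_top]
        _ ≤ ENNReal.ofReal (3 * K ^ 2) *
              ∫⁻ x in {x : EuclideanSpace ℝ (Fin 3) | a ≤ ‖x‖}, ENNReal.ofReal (‖x‖ ^ (-(4 : ℝ))) :=
            mul_le_mul' le_rfl (lintegral_mono_set inter_subset_right)
        _ ≤ ENNReal.ofReal (3 * K ^ 2) * (ENNReal.ofReal a⁻¹ * J₁e) :=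
            mul_le_mul' le_rfl (lintegral_norm_rpow_neg_four_ge_le ha0)
        _ = ENNReal.ofReal (3 * K ^ 2 * J₁ / (R * Real.sqrt (-t))) := by
            rw [hJ₁, ← ENNReal.ofReal_toReal hJ₁top, ← ENNReal.ofReal_mul (by positivity),
              ← ENNReal.ofReal_mul (by positivity), ENNReal.ofReal_toReal hJ₁top]
            congr 1
            rw [ha]
            field_simp
    -- assemble the slice bound
    calc ∫⁻ x in ball (0 : EuclideanSpace ℝ (Fin 3)) r, ENNReal.ofReal (frobeniusNormSq (fderiv ℝ (u t) x))
        ≤ ∫⁻ x in core ∪ tail, ENNReal.ofReal (frobeniusNormSq (fderiv ℝ (u t) x)) :=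
          lintegral_mono_set hcover
      _ ≤ (∫⁻ x in core, ENNReal.ofReal (frobeniusNormSq (fderiv ℝ (u t) x))) +
            ∫⁻ x in tail, ENNReal.ofReal (frobeniusNormSq (fderiv ℝ (u t) x)) :=
          lintegral_union_le _ _ _
      _ ≤ ENNReal.ofReal (4 * θ ^ 2 / Real.sqrt (-t)) +
            ENNReal.ofReal (3 * K ^ 2 * J₁ / (R * Real.sqrt (-t))) :=
          add_le_add (hcore t htT) htail_int
      _ = ENNReal.ofReal (4 * θ ^ 2 / Real.sqrt (-t) + 3 * K ^ 2 * J₁ / (R * Real.sqrt (-t))) :=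
          (ENNReal.ofReal_add (by positivity) (by positivity)).symm
      _ ≤ ENNReal.ofReal (5 * θ ^ 2 / Real.sqrt (-t)) := by
          refine ENNReal.ofReal_le_ofReal ?_
          have e : 4 * θ ^ 2 / Real.sqrt (-t) + 3 * K ^ 2 * J₁ / (R * Real.sqrt (-t)) =
              (4 * θ ^ 2 + 3 * K ^ 2 * J₁ / R) / Real.sqrt (-t) := by
            field_simp
          rw [e]
          refine div_le_div_of_nonneg_right ?_ hsq.le
          linarith
  -- (9.16)
  have h := cknE_le_of_slice_bound (G := fun t x => fderiv ℝ (u t) x) hr (by positivity : (0 : ℝ) ≤ 5 * θ ^ 2)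
    hFm hslice
  refine h.trans (le_of_eq ?_)
  congr 1
  ring

end SmallDissipation

end Literature.Analysis.FluidPDE

end
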